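import Summits.CriticalPhenomena.CardyFormulaZ2.Theses.ModulusResponse

/-!
# Route `ModulusResponse`, glue support `LinearImageFromSegment`

Item `stmt-CriticalPhenomena-14424` (decl
`Summit.CriticalPhenomena.CardyFormulaZ2.Theses.ModulusResponse.LinearImageFromSegment`), proved
(`linearImageFromSegment_proof`): the segment chain delivers linear-image Cardy on `ℤ²`
(`LinearImageCardyZ2`) by name, inputs first —
`SegmentRSW → SmirnovCellAnchor → SmirnovResponse → SegmentTransport → BondIdentification →
LinearImageCardyZ2`.

Pure logic, the body of the route's deciding theorem `closes` without its first step
(`SquarePinning`): given stretches `S` pinned by their formula, instantiate the cell family `μ` by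
its defining term (hypothesis by `rfl`), feed `SegmentTransport μ S` with `SegmentRSW μ`, the anchor
`⟨-(log 3)/4, SmirnovCellAnchor μ S⟩` and `SmirnovResponse μ S`, take `u = 1/2 ∈ [0, 1/2]`, and
rewrite `μ (1/2) = bondPercolation (zdGraph 2) half` by `BondIdentification`
(`discreteCrossingProb` unfolds by `rfl`).
-/

namespace Summit.CriticalPhenomena.CardyFormulaZ2.Theorems

open Summit.CriticalPhenomena.CardyFormulaZ2.Theses.ModulusResponse

/-- **Glue item `LinearImageFromSegment` of route `ModulusResponse`.** Uniform RSW on the segment,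
Smirnov's theorem in the `ℤ²` frame at `u = 0`, the first-order response law at `u = 0`, transport
of linear-image Cardy along the self-dual cell segment and the identification of the cell measure
at `u = 1/2` with `P_{1/2}` bond percolation on `ℤ²` together give linear-image Cardy on `ℤ²`
(`LinearImageCardyZ2`). Pure logic (the body of `closes`). -/
theorem linearImageFromSegment_proof :
    Summit.CriticalPhenomena.CardyFormulaZ2.Theses.ModulusResponse.LinearImageFromSegment := by
  unfold LinearImageFromSegment
  intro hRSW hAnchor hResp hTrans hBond S hS
  suffices h : ∀ μ : ℝ → MeasureTheory.Measure
      (Literature.Probability.Percolation.BondConfig (Literature.Probability.LatticeModels.Site 2)),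
      (∀ u, μ u = MeasureTheory.Measure.map
        (fun p : Set (Literature.Probability.LatticeModels.Site 2) ×
            Set (Literature.Probability.LatticeModels.Site 2) ↦
          {e | ∃ m, (m ∈ p.1 ∧ e = s(m - Pi.single 0 1, m)) ∨
            ((m ∈ p.1 ↔ m ∉ p.2) ∧ e = s(m - Pi.single 1 1, m))})
        ((ProbabilityTheory.setBernoulli Set.univ Literature.Probability.Percolation.half).prod
          (ProbabilityTheory.setBernoulli Set.univ (Set.projIcc 0 1 zero_le_one u)))) →
      ∃ t : ℝ, ∀ R : Literature.Probability.RandomPlanarGeometry.ConformalRectangle,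
        R.HasCrossingLimit (fun δ ↦ Literature.Probability.Percolation.discreteCrossingProb
          Literature.Probability.Percolation.half (S t '' R.carrier) δ (S t '' R.arc 0) (S t '' R.arc 2))
          Literature.Probability.RandomPlanarGeometry.cardyFunction from
    h _ (fun _ ↦ rfl)
  intro μ hμ
  have hmem : (1 / 2 : ℝ) ∈ Set.Icc (0 : ℝ) (1 / 2) := ⟨by norm_num, le_rfl⟩
  obtain ⟨t, ht⟩ := hTrans μ S hμ hS (hRSW μ hμ) ⟨-(Real.log 3) / 4, hAnchor μ S hμ hS⟩
    (hResp μ S hμ hS) (1 / 2) hmem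
  refine ⟨t, fun R ↦ ?_⟩
  have hR := ht R
  rw [hBond μ hμ] at hR
  exact hR

end Summit.CriticalPhenomena.CardyFormulaZ2.Theorems
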